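import Summits.Ventures.QEC.Census.CertCheckBZFast
import Summits.Ventures.QEC.Census.BB.BB90.BZData
import HarnessLib

/-!
# `BB90` — `bz` certificate, side Z: ENUMERATION verdicts 24/34, tier KERNEL (CERTIFIED: decide +kernel; axioms ⊆ {propext, Classical.choice, Quot.sound})

For each (block `b`, matrix `i`) listed: `cert.bzZEnum bzData b i = true` by `native_decide` — the
Brouwer–Zimmermann replay of matrix `i` of block `b`: every codeword `u · G_i` with `1 ≤ |u| ≤ t_i` has weight
`> wmax` or is allow-listed (CERT-FORMAT C4 / C17 (7)); tactic `decide +kernel`. KERNEL tier: each matrix ≲ 4·10⁵ codewords (type-10 22:34:29Z: 1–6·10³ visits/s in the kernel); `set_option maxHeartbeats 1000000` per theorem because one matrix exceeds the default deterministic budget of the kernel (qec-search-7: BB90 matrix of 1.6·10⁵ codewords timed out at 200000), memory guard untouched.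
Structure (`BZStructZ`), information sets (`BZInfoSetsZ*`) and bounds (`BZBoundsZ`) are KERNEL files.
-/

namespace Summit.Ventures.QEC.Census.BB90

set_option maxHeartbeats 400000000 in
/-- Block 11, matrix 1, first rows 0 … 44 (164220 codewords): pass — FAST kernel shape `chunk1RF`/`bzTestZF` (`decide +kernel`). -/
theorem enumZ_11_1_r0 : chunk1RF (BB90.cert.bzTestZF) (BB90.cert.bzPosZ BB90.bzData 11 1) 3 0 45 = true := by
  decide +kernel

/-- Block 11, matrix 1: the BZ enumeration verdict, ASSEMBLED from its 1 fast first-row range(s) (tier KERNEL). -/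
theorem enumZ_11_1 : BB90.cert.bzZEnum BB90.bzData 11 1 = true :=
  BB90.cert.bzZEnum_of_scan BB90.bzData 11 1 (scan_origin_eq_true_of_chunk1 45 (by decide +kernel) (by decide +kernel)
    (forall_lt_append (forall_lt_zero) (forall_of_chunk1RF BB90.cert.bzTestZF_eq enumZ_11_1_r0)))

end Summit.Ventures.QEC.Census.BB90
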